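import Literature.NumberTheory.GelbartRogawski1991.LocalUnitaryUndoubling
import Literature.NumberTheory.GelbartRogawski1991.FiniteAdelicSplittingAssembly
import Literature.NumberTheory.Automorphic.UnitaryGroupRestrictedProduct
import Literature.NumberTheory.Automorphic.FiniteAdeleSchwartzBruhatDirectSum
import Literature.NumberTheory.Weil1964.AdelicMetaplecticReindex
import HarnessLib

-- buildfix G11b-3 recipe (LEDGER B13-1/B13-3), as in the GelbartRogawski1991 siblings: elaborate sequentially so the
-- trailing `attribute [implicit_reducible]` block is in force at `.olean` export (inert for the kernel).
set_option Elab.async false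

/-!
# Finite-adelic undoubling: `U(𝕍)(𝔸_f) × 1 ⊂ U(𝕍 ⊕ −𝕍)(𝔸_f)` and the restricted tensor product of the local undoublings

[GelbartRogawski1991, §3.1 Prop. 3.1.1 p. 455 L1–3] by doubling ([Kudla1994, Thm. 3.1]; [HarrisKudlaSweet1996, §1]),
finite-adelic half.  The tree undoubles a splitting of the DOUBLED group `H = U(T₀ ⊕ −T₀)` in two ways: GLOBALLY
(`GRConstruction.undoubleHom`: restrict `sD : H(𝔸) →* Mp(𝕎^𝔻)ᶜᵒⁿᵗ` to `U(𝕍) × 1` and strip `⊠`) and LOCALLY, place by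
place (`LocalUnitaryUndoubling.undoubleLoc`, assembled over the finite places as a `FinLocalSplittings` in
`LocalUnitarySplittingsCM`).  This file is the finite-adelic bookkeeping that compares the two:

* (the homomorphism `inlFin : U(J)(𝔸_f) →* U(J^𝔻)(𝔸_f)`, `g ↦ g ⊕ 1`, and its components `(g ⊕ 1)_v = inlLoc g_v`
  are the sibling leaf `FiniteAdelicUnitaryUndoubling` (pin-3); this file is DECOUPLED from it: §3 is stated for any
  `h ∈ U(J^𝔻)(𝔸_f)` with `h_v = inlLoc g_v` at every finite place — hypothesis `hh`, discharged there by `evalPlace_inlFin`);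
* §1 **the finite box `f₁ ⊠_f f₂ ∈ 𝒮((𝔸_f)^{n+n})` along `e₂ : Fin n ⊕ Fin n ≃ Fin (n + n)`** (`boxFin`, the tree's
  `finSumEquiv (f₁ ⊗ f₂)` reindexed by `finSBReindex e₂`), and **the finite box of place-pure tensors is the place-pure
  tensor of the local boxes**: `(⊗_v φ_v) ⊠_f (⊗_v φ'_v) = ⊗_v (φ_v ⊠ φ'_v)` (`boxFin_piProdSB`, local `boxSB` of
  `LocalSchwartzBruhatDirectSum`);
* §2 **`FinLocalSplittings.undouble`**: a family `𝓢^𝔻` of local splittings of the doubled group yields the family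
  `v ↦ undoubleLoc (𝓢^𝔻.s v)` of local splittings of `U(J)` (over `ι_v`, smooth, unramified a.e. — the three transfer
  theorems of `LocalUnitaryUndoubling`);
* §3 **THE PLACE-ASSEMBLED UNDOUBLING IDENTITY** on `𝒮((𝔸_f)^{n+n})`:
  `Ω^𝔻(h) (f₁ ⊠_f f₂) = (Ω(g) f₁) ⊠_f f₂` for every `h` with `h_v = inlLoc g_v` (all `v`), where `Ω^𝔻 = ⊗'_v ω^𝔻_v` is the
  finite-adelic Weil representation of `𝓢^𝔻` and `Ω = ⊗'_v ω_v` that of ANY family `𝓢` whose members are the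
  `undoubleLoc (s^𝔻_v)` (hypothesis `hs`, `rfl` for `𝓢^𝔻.undouble`) (`Omega_boxFin_of_evalPlace_eq`, `…_undouble`; on
  place-pure tensors `Omega_boxFin_piProdSB_of_evalPlace_eq` = `Omega_piProdSB` on both sides + `boxFin_piProdSB` + the local
  `toRep_undoubleLoc_boxSB` at every place; in general by bilinearity, pure tensors spanning `𝒮_f`).

Topic `NumberTheory/GelbartRogawski1991`; namespace `Literature.NumberTheory.GelbartRogawski1991.UnitaryDualPair.LocalSplitting`
(that of `LocalUnitaryUndoubling` / `FiniteAdelicSplittingAssembly`).  KERNEL MATHEMATICS ONLY: definitions with bodies +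
theorems; no named fact, no `sorry`.

## References
* [GelbartRogawski1991] S. Gelbart, J. Rogawski, Invent. Math. 105 (1991), §3.1 Prop. 3.1.1 p. 455 L1–3, (3.1.3) p. 456.
* [Kudla1994] S. Kudla, Israel J. Math. 87 (1994), §2, Thm. 3.1.
* [MoeglinVignerasWaldspurger1987] LNM 1291 (1987), Chap. 2 II.1 Rem. (6).
* [Weil1964] A. Weil, Acta Math. 111 (1964), Chap. III n° 37–38 pp. 188–190 (`𝐫_𝔸 = ⊗_v 𝐫_v`).

## Provenance

LEAN-IN-TREE rule; leaf (H3-L1) of the (ρ1) plan `RHO1-HFAC-PLAN.md` (own-htheta g6; arbitration: decoupled `h, hh` form),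
seat pin-1 (pub-hodgecm2).
-/

set_option autoImplicit false

noncomputable section

open scoped TensorProduct
open NumberField IsDedekindDomain Matrix Filter
open Literature.RepresentationTheory.HeisenbergGroup
open Literature.NumberTheory.Automorphic Literature.NumberTheory.Weil1964

namespace Literature.NumberTheory.GelbartRogawski1991.UnitaryDualPair.LocalSplitting

variable (F : Type) [Field F] [NumberField F] (E : Type) [Field E] [NumberField E] [Algebra F E] (c : E ≃ₐ[F] E)
  (n : ℕ) {T₀ : Matrix (Fin n) (Fin n) F}
  {J : Matrix (Fin n) (Fin n) E} (hJ : J = T₀.map (algebraMap F E))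
  {JD : Matrix (Fin (n + n)) (Fin (n + n)) E} (hJD : JD = (gramD F n T₀).map (algebraMap F E))

/-! ## §1 The finite box `f₁ ⊠_f f₂ ∈ 𝒮((𝔸_f)^{n+n})` along `e₂` and place-pure tensors -/

/-- **`f₁ ⊠_f f₂ ∈ 𝒮((𝔸_{F,f})^{n+n})`**, `(f₁ ⊠_f f₂)(b) = f₁(b ∘ e₂ ∘ inl) f₂(b ∘ e₂ ∘ inr)`: the tree's
`finSumEquiv (f₁ ⊗ f₂) ∈ 𝒮((𝔸_f)^{Fin n ⊕ Fin n})` reindexed along `e₂` (`finSBReindex`).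
[cite: Weil1964, Chap. III n° 37–38 pp. 188–190] -/
def boxFin (f₁ f₂ : FinSB F (Fin n)) : FinSB F (Fin (n + n)) :=
  finSBReindex F (e₂ n) (finSumEquiv F (Fin n) (Fin n) (f₁ ⊗ₜ f₂))

/-- formula for `f₁ ⊠_f f₂`. [cite: Weil1964, Chap. III n° 37–38 pp. 188–190] -/
theorem coe_boxFin_apply (f₁ f₂ : FinSB F (Fin n)) (b : Fin (n + n) → FiniteAdeleRing (𝓞 F) F) :
    (boxFin F n f₁ f₂ : (Fin (n + n) → FiniteAdeleRing (𝓞 F) F) → ℂ) b =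
      (f₁ : (Fin n → FiniteAdeleRing (𝓞 F) F) → ℂ) (fun i => b (e₂ n (Sum.inl i))) *
        (f₂ : (Fin n → FiniteAdeleRing (𝓞 F) F) → ℂ) (fun i => b (e₂ n (Sum.inr i))) := by
  rw [boxFin, coe_finSBReindex_apply, coe_finSumEquiv_tmul]
  rfl

/-- `⊠_f` as a bilinear map. [cite: Weil1964, Chap. III n° 37–38 pp. 188–190] -/
def boxFinₗ : FinSB F (Fin n) →ₗ[ℂ] FinSB F (Fin n) →ₗ[ℂ] FinSB F (Fin (n + n)) :=
  ((TensorProduct.mk ℂ (FinSB F (Fin n)) (FinSB F (Fin n))).compr₂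
    ((finSBReindex F (e₂ n)).toLinearMap ∘ₗ (finSumEquiv F (Fin n) (Fin n)).toLinearMap))

/-- `boxFinₗ f₁ f₂ = f₁ ⊠_f f₂`. [cite: Weil1964, Chap. III n° 37–38 pp. 188–190] -/
@[simp] theorem boxFinₗ_apply (f₁ f₂ : FinSB F (Fin n)) : boxFinₗ F n f₁ f₂ = boxFin F n f₁ f₂ := rfl

/-- `⊠_f` is additive on the left. [cite: Weil1964, Chap. III n° 37–38 pp. 188–190] -/
theorem boxFin_add_left (f₁ f₁' f₂ : FinSB F (Fin n)) :
    boxFin F n (f₁ + f₁') f₂ = boxFin F n f₁ f₂ + boxFin F n f₁' f₂ := by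
  rw [← boxFinₗ_apply, map_add, LinearMap.add_apply, boxFinₗ_apply, boxFinₗ_apply]

/-- `⊠_f` is homogeneous on the left. [cite: Weil1964, Chap. III n° 37–38 pp. 188–190] -/
theorem boxFin_smul_left (a : ℂ) (f₁ f₂ : FinSB F (Fin n)) : boxFin F n (a • f₁) f₂ = a • boxFin F n f₁ f₂ := by
  rw [← boxFinₗ_apply, map_smul, LinearMap.smul_apply, boxFinₗ_apply]

/-- `⊠_f` is additive on the right. [cite: Weil1964, Chap. III n° 37–38 pp. 188–190] -/
theorem boxFin_add_right (f₁ f₂ f₂' : FinSB F (Fin n)) :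
    boxFin F n f₁ (f₂ + f₂') = boxFin F n f₁ f₂ + boxFin F n f₁ f₂' := by
  rw [← boxFinₗ_apply, map_add, boxFinₗ_apply, boxFinₗ_apply]

/-- `⊠_f` is homogeneous on the right. [cite: Weil1964, Chap. III n° 37–38 pp. 188–190] -/
theorem boxFin_smul_right (a : ℂ) (f₁ f₂ : FinSB F (Fin n)) : boxFin F n f₁ (a • f₂) = a • boxFin F n f₁ f₂ := by
  rw [← boxFinₗ_apply, map_smul, boxFinₗ_apply]

/-- **the family of local boxes** `v ↦ φ_v ⊠ φ'_v ∈ 𝒮(F_v^{n+n})` of two restricted families (restricted again: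
`1_{𝒪_v^{n+n}} = 1_{𝒪_v^n} ⊠ 1_{𝒪_v^n}`, `unitVec_eq_boxSB`). [cite: Weil1964, Chap. III n° 37–38 pp. 188–190] -/
def boxFamily (φ₁ φ₂ : LocalSBFamily F (Fin n)) : LocalSBFamily F (Fin (n + n)) :=
  ⟨fun v => boxSB (v.adicCompletion F) (e₂ n) (φ₁ v) (φ₂ v),
    (φ₁.eventually_eq.and φ₂.eventually_eq).mono fun v hv => by
      change boxSB (v.adicCompletion F) (e₂ n) (φ₁ v) (φ₂ v) ∈ ({unitVec F (Fin (n + n)) v} : Set _)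
      rw [Set.mem_singleton_iff, unitVec_eq_boxSB F v n, hv.1, hv.2]⟩

/-- components of the box family. [cite: Weil1964, Chap. III n° 37–38 pp. 188–190] -/
@[simp] theorem boxFamily_apply (φ₁ φ₂ : LocalSBFamily F (Fin n)) (v : HeightOneSpectrum (𝓞 F)) :
    boxFamily F n φ₁ φ₂ v = boxSB (v.adicCompletion F) (e₂ n) (φ₁ v) (φ₂ v) := rfl

/-- **the finite box of place-pure tensors is the place-pure tensor of the local boxes**:
`(⊗_v φ_v) ⊠_f (⊗_v φ'_v) = ⊗_v (φ_v ⊠ φ'_v)` as functions on `(𝔸_f)^{n+n}` (both sides are finite products over the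
same places). [cite: Weil1964, Chap. III n° 37–38 pp. 188–190] -/
theorem boxFin_piProdSB (φ₁ φ₂ : LocalSBFamily F (Fin n)) :
    boxFin F n (piProdSB F (Fin n) φ₁) (piProdSB F (Fin n) φ₂) = piProdSB F (Fin (n + n)) (boxFamily F n φ₁ φ₂) := by
  apply Subtype.ext
  funext b
  rw [coe_boxFin_apply, coe_piProdSB, coe_piProdSB, coe_piProdSB]
  -- a common finite set of exceptional places
  obtain ⟨S₁, hφ₁, hb₁⟩ := exists_finset_exceptional φ₁ (fun i => b (e₂ n (Sum.inl i)))
  obtain ⟨S₂, hφ₂, hb₂⟩ := exists_finset_exceptional φ₂ (fun i => b (e₂ n (Sum.inr i)))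
  classical
  have hφ₁' : ∀ v ∉ S₁ ∪ S₂, φ₁ v = unitVec F (Fin n) v := fun v hv => hφ₁ v fun h => hv (Finset.mem_union_left _ h)
  have hφ₂' : ∀ v ∉ S₁ ∪ S₂, φ₂ v = unitVec F (Fin n) v := fun v hv => hφ₂ v fun h => hv (Finset.mem_union_right _ h)
  have hb₁' : ∀ v ∉ S₁ ∪ S₂, ∀ i, b (e₂ n (Sum.inl i)) v ∈ v.adicCompletionIntegers F :=
    fun v hv => hb₁ v fun h => hv (Finset.mem_union_left _ h)
  have hb₂' : ∀ v ∉ S₁ ∪ S₂, ∀ i, b (e₂ n (Sum.inr i)) v ∈ v.adicCompletionIntegers F :=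
    fun v hv => hb₂ v fun h => hv (Finset.mem_union_right _ h)
  have hbox : ∀ v ∉ S₁ ∪ S₂, boxFamily F n φ₁ φ₂ v = unitVec F (Fin (n + n)) v := fun v hv => by
    rw [boxFamily_apply, hφ₁' v hv, hφ₂' v hv, unitVec_eq_boxSB F v n]
  have hb : ∀ v ∉ S₁ ∪ S₂, ∀ k, b k v ∈ v.adicCompletionIntegers F := fun v hv k => by
    obtain ⟨i, rfl⟩ := (e₂ n).surjective k
    rcases i with i | i
    · exact hb₁' v hv i
    · exact hb₂' v hv i
  rw [piProd_eq_prod φ₁ _ (S₁ ∪ S₂) hφ₁' hb₁', piProd_eq_prod φ₂ _ (S₁ ∪ S₂) hφ₂' hb₂',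
    piProd_eq_prod _ b (S₁ ∪ S₂) hbox hb, ← Finset.prod_mul_distrib]
  refine Finset.prod_congr rfl fun v _ => ?_
  rw [localFactor_apply, localFactor_apply, localFactor_apply, boxFamily_apply, coe_boxSB]
  rfl

/-! ## §2 Undoubling a family of local splittings of the doubled group -/

variable [Algebra.IsQuadraticExtension F E] {δ : E} (hcδ : c δ = -δ) (hδ : δ ≠ 0) {d : F} (hd : δ * δ = algebraMap F E d)
  (hT₀ : T₀.IsSymm) (hT₀d : IsUnit T₀.det)

namespace FinLocalSplittings

variable {F E c n hJD hcδ hδ hd}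
variable (𝓢D : FinLocalSplittings F E c (n + n) hcδ hδ hd (gramD F n T₀) (gramD_isSymm F n hT₀) hJD)

/-- **undoubling a family**: from local splittings `s^𝔻_v` of the DOUBLED group `U(J^𝔻)(F_v)` over `ι^𝔻_v` to the local
splittings `undoubleLoc s^𝔻_v : U(J)(F_v) →* S̃p(𝕎_v)` over `ι_v` — smooth and unramified almost everywhere by the transfer
theorems of `LocalUnitaryUndoubling`. [cite: GelbartRogawski1991, §3.1 Prop. 3.1.1 p. 455 L1–3] -/
def undouble : FinLocalSplittings F E c n hcδ hδ hd T₀ hT₀ hJ where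
  s v := undoubleLoc F E c v n hJ hJD hcδ hδ hd hT₀ hT₀d (𝓢D.s v) (𝓢D.proj_s v)
  proj_s v g := proj_undoubleLoc F E c v n hJ hJD hcδ hδ hd hT₀ hT₀d (𝓢D.s v) (𝓢D.proj_s v) g
  smooth v := by
    intro Φ
    have hne : unitVec F (Fin n) v ≠ 0 := fun h0 => by
      have h1 : ((unitVec F (Fin n) v : SchwartzBruhat (Fin n → v.adicCompletion F)) : (Fin n → v.adicCompletion F) → ℂ) 0 = 1 :=
        unitVec_apply_of_mem fun i _ => (v.adicCompletionIntegers F).zero_mem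
      rw [h0, ZeroMemClass.coe_zero, Pi.zero_apply] at h1
      exact zero_ne_one h1
    obtain ⟨U, hU, hfix⟩ := exists_open_forall_toRep_undoubleLoc_eq F E c v n hJ hJD hcδ hδ hd hT₀ hT₀d (𝓢D.s v)
      (𝓢D.proj_s v) Φ hne ⟨(𝓢D.omegaLoc v).stabilizerSubgroup (boxSB (v.adicCompletion F) (e₂ n) Φ (unitVec F (Fin n) v)),
        𝓢D.smooth v _, fun k hk => (Representation.mem_stabilizerSubgroup _ _ _).1 hk⟩
    exact Representation.isSmoothVector_of_le _ hU fun k hk => (Representation.mem_stabilizerSubgroup _ _ _).2 (hfix k hk)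
  unramified := 𝓢D.unramified.mono fun v hv =>
    toRep_undoubleLoc_unitVec F E c v n hJ hJD hcδ hδ hd hT₀ hT₀d (𝓢D.s v) (𝓢D.proj_s v) hv

/-- the undoubled family at `v` is `undoubleLoc (s^𝔻_v)`. [cite: GelbartRogawski1991, §3.1 Prop. 3.1.1 p. 455 L1–3] -/
@[simp] theorem undouble_s (v : HeightOneSpectrum (𝓞 F)) :
    (𝓢D.undouble hJ hT₀ hT₀d).s v = undoubleLoc F E c v n hJ hJD hcδ hδ hd hT₀ hT₀d (𝓢D.s v) (𝓢D.proj_s v) := rfl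

/-! All statements below are made for ANY family `𝓢` of local splittings of `U(J)` whose members ARE the local undoublings
`undoubleLoc (s^𝔻_v)` (hypothesis `hs`, which is `fun _ => rfl` for `𝓢 := 𝓢D.undouble …` and for any family built field-wise
from `undoubleLoc` of the `s^𝔻_v`, e.g. `GRConstruction.undoubledSplittings`), and for ANY `h ∈ U(J^𝔻)(𝔸_f)` whose place
components are `h_v = inlLoc g_v` (hypothesis `hh`, which is `evalPlace_inlFin` for `h := inlFin g`). -/

variable (𝓢 : FinLocalSplittings F E c n hcδ hδ hd T₀ hT₀ hJ)
  (hs : ∀ v, 𝓢.s v = undoubleLoc F E c v n hJ hJD hcδ hδ hd hT₀ hT₀d (𝓢D.s v) (𝓢D.proj_s v))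

include hs in
/-- **the local undoubling identity in `omegaLoc` form**: `ω^𝔻_v(inlLoc g)(f₁ ⊠ f₂) = (ω_v(g) f₁) ⊠ f₂`.
[cite: MoeglinVignerasWaldspurger1987, Chap. 2 II.1 Rem. (6)] -/
theorem omegaLoc_inlLoc_boxSB (v : HeightOneSpectrum (𝓞 F)) (g : UnitaryGroup.localPi E c n J v)
    (f₁ f₂ : SchwartzBruhat (Fin n → v.adicCompletion F)) :
    𝓢D.omegaLoc v (inlLoc F E c v n hJ hJD g) (boxSB (v.adicCompletion F) (e₂ n) f₁ f₂) =
      boxSB (v.adicCompletion F) (e₂ n) (𝓢.omegaLoc v g f₁) f₂ := by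
  change (MpPsi.toRep (localSchrodinger F (n + n) (gramD F n T₀) v)).comp (𝓢D.s v) (inlLoc F E c v n hJ hJD g)
      (boxSB (v.adicCompletion F) (e₂ n) f₁ f₂) =
    boxSB (v.adicCompletion F) (e₂ n) ((MpPsi.toRep (localSchrodinger F n T₀ v)).comp (𝓢.s v) g f₁) f₂
  rw [hs v]
  exact toRep_undoubleLoc_boxSB F E c v n hJ hJD hcδ hδ hd hT₀ hT₀d (𝓢D.s v) (𝓢D.proj_s v) g f₁ f₂

/-! ## §3 The place-assembled undoubling identity `Ω^𝔻(h)(f₁ ⊠_f f₂) = (Ω(g) f₁) ⊠_f f₂` for `h_v = g_v ⊕ 1` -/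

include hs in
/-- **on place-pure tensors**: `Ω^𝔻(h) ((⊗_v φ_v) ⊠_f (⊗_v φ'_v)) = (Ω(g) (⊗_v φ_v)) ⊠_f (⊗_v φ'_v)` for every
`h ∈ U(J^𝔻)(𝔸_f)` whose place components are `h_v = g_v ⊕ 1 = inlLoc g_v` (hypothesis `hh`; for `h := inlFin g` it is the
sibling leaf's `evalPlace_inlFin`) — `Omega_piProdSB` on both sides, `boxFin_piProdSB`, and the local `toRep_undoubleLoc_boxSB`
at every place. [cite: GelbartRogawski1991, §3.1 Prop. 3.1.1 p. 455 L1–3; Weil1964, Chap. III n° 37–38 pp. 188–190] -/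
theorem Omega_boxFin_piProdSB_of_evalPlace_eq (g : UnitaryGroup.finAdelic F E c n J)
    (h : UnitaryGroup.finAdelic F E c (n + n) JD)
    (hh : ∀ v, UnitaryGroup.evalPlace F E c (n + n) JD v h = inlLoc F E c v n hJ hJD (UnitaryGroup.evalPlace F E c n J v g))
    (φ₁ φ₂ : LocalSBFamily F (Fin n)) :
    𝓢D.Omega h (boxFin F n (piProdSB F (Fin n) φ₁) (piProdSB F (Fin n) φ₂)) =
      boxFin F n (𝓢.Omega g (piProdSB F (Fin n) φ₁)) (piProdSB F (Fin n) φ₂) := by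
  rw [boxFin_piProdSB, Omega_piProdSB, Omega_piProdSB, boxFin_piProdSB]
  congr 1
  refine Subtype.ext (funext fun v => ?_)
  change RestrictedFamily.smul 𝓢D.omegaLoc 𝓢D.unitVec_mem_fixedPoints
      (UnitaryGroup.finAdelicEquiv F E c (n + n) JD h) (boxFamily F n φ₁ φ₂) v =
    boxSB (v.adicCompletion F) (e₂ n)
      (RestrictedFamily.smul 𝓢.omegaLoc 𝓢.unitVec_mem_fixedPoints (UnitaryGroup.finAdelicEquiv F E c n J g) φ₁ v) (φ₂ v)
  rw [smul_apply, smul_apply, boxFamily_apply, hh v, 𝓢D.omegaLoc_inlLoc_boxSB hJ hT₀ hT₀d 𝓢 hs]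

include hs in
/-- **THE PLACE-ASSEMBLED UNDOUBLING IDENTITY**: `Ω^𝔻(h) (f₁ ⊠_f f₂) = (Ω(g) f₁) ⊠_f f₂` for ALL `f₁, f₂ ∈ 𝒮((𝔸_{F,f})^n)`
and every `h ∈ U(J^𝔻)(𝔸_f)` with `h_v = inlLoc g_v` at every finite place (place-pure tensors span, both sides bilinear).
[cite: GelbartRogawski1991, §3.1 Prop. 3.1.1 p. 455 L1–3; Weil1964, Chap. III n° 37–38 pp. 188–190] -/
theorem Omega_boxFin_of_evalPlace_eq (g : UnitaryGroup.finAdelic F E c n J) (h : UnitaryGroup.finAdelic F E c (n + n) JD)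
    (hh : ∀ v, UnitaryGroup.evalPlace F E c (n + n) JD v h = inlLoc F E c v n hJ hJD (UnitaryGroup.evalPlace F E c n J v g))
    (f₁ f₂ : FinSB F (Fin n)) :
    𝓢D.Omega h (boxFin F n f₁ f₂) = boxFin F n (𝓢.Omega g f₁) f₂ := by
  -- as bilinear maps, tested on the spanning place-pure tensors in each variable
  have key : (boxFinₗ F n).compr₂ (𝓢D.Omega h) = (boxFinₗ F n) ∘ₗ (𝓢.Omega g) :=
    LinearMap.ext_on_range (span_range_piProdSB (K := F) (ι := Fin n)) fun φ₁ =>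
      LinearMap.ext_on_range (span_range_piProdSB (K := F) (ι := Fin n)) fun φ₂ => by
        rw [LinearMap.compr₂_apply, LinearMap.comp_apply, boxFinₗ_apply, boxFinₗ_apply]
        exact 𝓢D.Omega_boxFin_piProdSB_of_evalPlace_eq hJ hT₀ hT₀d 𝓢 hs g h hh φ₁ φ₂
  have h := LinearMap.congr_fun (LinearMap.congr_fun key f₁) f₂
  rw [LinearMap.compr₂_apply, LinearMap.comp_apply, boxFinₗ_apply, boxFinₗ_apply] at h
  exact h

include hs in
/-- **the same identity in the `finSBReindex e₂ ∘ finSumEquiv` spelling** (no `boxFin` abbreviation; the shape consumed by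
`GRConstruction.UndoublingPlaceAssembly`): `Ω^𝔻(h) (R_{e₂} (f₁ ⊗ f₂)) = R_{e₂} ((Ω(g) f₁) ⊗ f₂)`.
[cite: GelbartRogawski1991, §3.1 Prop. 3.1.1 p. 455 L1–3; Weil1964, Chap. III n° 37–38 pp. 188–190] -/
theorem Omega_finSBReindex_finSumEquiv_of_evalPlace_eq (g : UnitaryGroup.finAdelic F E c n J)
    (h : UnitaryGroup.finAdelic F E c (n + n) JD)
    (hh : ∀ v, UnitaryGroup.evalPlace F E c (n + n) JD v h = inlLoc F E c v n hJ hJD (UnitaryGroup.evalPlace F E c n J v g))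
    (f₁ f₂ : FinSB F (Fin n)) :
    𝓢D.Omega h (finSBReindex F (e₂ n) (finSumEquiv F (Fin n) (Fin n) (f₁ ⊗ₜ f₂))) =
      finSBReindex F (e₂ n) (finSumEquiv F (Fin n) (Fin n) (𝓢.Omega g f₁ ⊗ₜ f₂)) :=
  𝓢D.Omega_boxFin_of_evalPlace_eq hJ hT₀ hT₀d 𝓢 hs g h hh f₁ f₂

/-- the identity for the canonical undoubled family `𝓢D.undouble` (`hs := fun _ => rfl`).
[cite: GelbartRogawski1991, §3.1 Prop. 3.1.1 p. 455 L1–3; Weil1964, Chap. III n° 37–38 pp. 188–190] -/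
theorem Omega_boxFin_of_evalPlace_eq_undouble (g : UnitaryGroup.finAdelic F E c n J)
    (h : UnitaryGroup.finAdelic F E c (n + n) JD)
    (hh : ∀ v, UnitaryGroup.evalPlace F E c (n + n) JD v h = inlLoc F E c v n hJ hJD (UnitaryGroup.evalPlace F E c n J v g))
    (f₁ f₂ : FinSB F (Fin n)) :
    𝓢D.Omega h (boxFin F n f₁ f₂) = boxFin F n ((𝓢D.undouble hJ hT₀ hT₀d).Omega g f₁) f₂ :=
  𝓢D.Omega_boxFin_of_evalPlace_eq hJ hT₀ hT₀d (𝓢D.undouble hJ hT₀ hT₀d) (fun _ => rfl) g h hh f₁ f₂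

end FinLocalSplittings

/-! ### Build-lane note (ops-buildfix G11b-3 recipe, as in the sibling GelbartRogawski1991 files): the public theorems are tagged
`[implicit_reducible]` purely to keep their large binder telescopes out of Lean's library-suggestion index at `lean -o`;
inert for the kernel, no statement or proof is changed. -/
set_option allowUnsafeReducibility true in
attribute [implicit_reducible]
  coe_boxFin_apply
  boxFinₗ_apply
  boxFin_add_left
  boxFin_smul_left
  boxFin_add_right
  boxFin_smul_right
  boxFamily_apply
  boxFin_piProdSB
  FinLocalSplittings.undouble_s
  FinLocalSplittings.omegaLoc_inlLoc_boxSB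
  FinLocalSplittings.Omega_boxFin_piProdSB_of_evalPlace_eq
  FinLocalSplittings.Omega_boxFin_of_evalPlace_eq
  FinLocalSplittings.Omega_finSBReindex_finSumEquiv_of_evalPlace_eq
  FinLocalSplittings.Omega_boxFin_of_evalPlace_eq_undouble

end Literature.NumberTheory.GelbartRogawski1991.UnitaryDualPair.LocalSplitting

end
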